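import Literature.Analysis.FluidPDE.NSFourierFamily
import Literature.Analysis.FluidPDE.NSRegFourierBilinear
import Mathlib.MeasureTheory.Function.L2Space
import HarnessLib

/-!
# Square-dominated Fourier-side families of time derivatives

Sixth file of the Fourier-side construction of the global regular solution of the
Leray-regularised Navier–Stokes system (discharge of
`Literature.Analysis.FluidPDE.leray_regularised_wellposed`). The tree's `IsFourierFamily`
(`NSFourierFamily`) records *pointwise* polynomial decay of every order, which the Fourier
coefficient field of a regularised solution with `L²` datum does not have (`𝓕u₀` is merely square
integrable). Here is the square-dominated variant adequate for `L²` data: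

* `IsDomFamily T n W` — `W₀, …, W_n : ℝ → E → ℂ` have a.e.-strongly measurable slices, are
  continuous in `t ∈ [0, T]` at each frequency, satisfy `∂ₜ W_k = W_{k+1}` within `[0, T]`, and for
  every `k ≤ n` and every `K` there is `G ∈ L²(E)` with `(1 + ‖ξ‖)^K ‖W_k(t, ξ)‖ ≤ G(ξ)` on
  `[0, T]` ("square-dominated of every order");
* its algebra (`mono`, `shift`, `add`, `neg`, `sub`, `symbol`, `const_mul`, `finset_sum`,
  `of_isFourierFamily`) and integrable dominators of every order (`dom_L1`);
* **`IsDomFamily.leibniz`** — the Leibniz family `∑ C(k,i) F_i ⋆ G_{k-i}` of two square-dominated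
  families is a (pointwise-decaying) `IsFourierFamily` (Cauchy–Schwarz: the convolution of two
  square-dominated functions decays pointwise to every order; differentiation under the integral
  sign with the product of dominators as bound), and the corollaries `nonlinFamily`, `presFamily`
  for the projected nonlinearity and the pressure symbol of two vector families.

With these, the time-derivative bootstrap and the synthesis of `NSFourierTimeRegularity`,
`NSFourierSynthesis` go through for square-dominated families (next files); cf. Leray 1934, §19,
pp. 220–221 (regularity of the solutions of the regularised system), Ożański–Pooley 2018,
Cor. 6.16/6.25, Lemarié-Rieusset 2016, §8.5.

## References

* J. Leray, Acta Math. 63 (1934), §19, §26. [Leray1934]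
* W. S. Ożański, B. C. Pooley, LMS Lecture Note Ser. 452 (2018), Cor. 6.16, Cor. 6.25. [OzanskiPooley2018]
* P. G. Lemarié-Rieusset, *The Navier–Stokes problem in the 21st century* (2016), §8.5.
-/

noncomputable section

open MeasureTheory Real Set Filter Topology Function
open scoped ENNReal ComplexConjugate

namespace Literature.Analysis.FluidPDE.FourierNS

section Family

variable {ι : Type*} [Fintype ι]

/-- `IsDomFamily T n W`: `W₀, …, W_n : ℝ → E → ℂ` have a.e.-strongly measurable time slices on
`[0, T]`, are square-dominated of every order uniformly on `[0, T]`
(`(1 + ‖ξ‖)^K ‖W_k(t, ξ)‖ ≤ G(ξ)`, `G ∈ L²`), continuous in `t ∈ [0, T]` at each frequency, and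
`∂ₜ W_k = W_{k+1}` within `[0, T]` (`k < n`) at each frequency. [folklore] -/
structure IsDomFamily (T : ℝ) (n : ℕ) (W : ℕ → ℝ → EuclideanSpace ℝ ι → ℂ) : Prop where
  /-- measurable time slices on `[0, T]` -/
  meas : ∀ k ≤ n, ∀ t ∈ Icc 0 T, AEStronglyMeasurable (W k t) volume
  /-- square domination of every order, uniformly on `[0, T]` -/
  dom : ∀ k ≤ n, ∀ K : ℕ, ∃ G : EuclideanSpace ℝ ι → ℝ, MemLp G 2 volume ∧
    ∀ t ∈ Icc 0 T, ∀ ξ, (1 + ‖ξ‖) ^ K * ‖W k t ξ‖ ≤ G ξ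
  /-- continuity in time on `[0, T]` at each frequency -/
  cont : ∀ k ≤ n, ∀ ξ, ContinuousOn (fun t => W k t ξ) (Icc 0 T)
  /-- `∂ₜ W_k = W_{k+1}` within `[0, T]` -/
  deriv : ∀ k < n, ∀ ξ, ∀ t ∈ Icc 0 T, HasDerivWithinAt (fun s => W k s ξ) (W (k + 1) t ξ) (Icc 0 T) t

variable {T : ℝ} {n : ℕ} {W W' F G : ℕ → ℝ → EuclideanSpace ℝ ι → ℂ}

/-! #### Dominators -/

/-- `(1 + ‖ξ‖)^{-(card ι + 1)} ∈ L²(E)`. [folklore] -/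
theorem memLp_inv_one_add_norm_pow_two :
    MemLp (fun ξ : EuclideanSpace ℝ ι => ((1 + ‖ξ‖) ^ (Fintype.card ι + 1))⁻¹) 2 volume := by
  have hc : Continuous fun ξ : EuclideanSpace ℝ ι => ((1 + ‖ξ‖) ^ (Fintype.card ι + 1))⁻¹ :=
    Continuous.inv₀ (by fun_prop) fun ξ => by positivity
  refine (memLp_two_iff_integrable_sq hc.aestronglyMeasurable).2 ?_
  have := integrable_inv_one_add_norm_pow (E := EuclideanSpace ℝ ι) (K := 2 * (Fintype.card ι + 1))
    (by rw [finrank_euclideanSpace]; omega)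
  refine this.congr (Eventually.of_forall fun ξ => ?_)
  simp only [inv_pow, ← pow_mul, mul_comm (Fintype.card ι + 1) 2]

/-- A pointwise-decaying family is square-dominated (`G = C (1+‖ξ‖)^{-K₀}`, `2K₀ > card ι`). [folklore] -/
theorem IsFourierFamily.isDomFamily (h : IsFourierFamily T n W) : IsDomFamily T n W where
  meas := h.meas
  dom k hk K := by
    set K₀ := Fintype.card ι + 1
    obtain ⟨C, hC⟩ := h.decay k hk (K + K₀)
    refine ⟨fun ξ => |C| * ((1 + ‖ξ‖) ^ K₀)⁻¹, ?_, fun t ht ξ => ?_⟩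
    · exact (memLp_inv_one_add_norm_pow_two (ι := ι)).const_mul |C|
    · have h1 := (hC t ht).pow_mul_norm_le (n := K) (K := K₀) ξ
      calc (1 + ‖ξ‖) ^ K * ‖W k t ξ‖ ≤ C * ((1 + ‖ξ‖) ^ K₀)⁻¹ := by
            calc (1 + ‖ξ‖) ^ K * ‖W k t ξ‖ = ‖W k t ξ‖ * (1 + ‖ξ‖) ^ K := mul_comm _ _
              _ ≤ C * ((1 + ‖ξ‖) ^ (K + K₀))⁻¹ * (1 + ‖ξ‖) ^ K :=
                  mul_le_mul_of_nonneg_right (hC t ht ξ) (by positivity)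
              _ = C * ((1 + ‖ξ‖) ^ K₀)⁻¹ := by
                  have hpos : 0 < 1 + ‖ξ‖ := by positivity
                  rw [pow_add, mul_inv]
                  field_simp
        _ ≤ |C| * ((1 + ‖ξ‖) ^ K₀)⁻¹ := mul_le_mul_of_nonneg_right (le_abs_self C) (by positivity)
  cont := h.cont
  deriv := h.deriv

/-- Dominators are nonnegative. [folklore] -/
theorem IsDomFamily.dom_nonneg {G₀ : EuclideanSpace ℝ ι → ℝ} {k K : ℕ} (hT : 0 ≤ T)
    (hG : ∀ t ∈ Icc 0 T, ∀ ξ, (1 + ‖ξ‖) ^ K * ‖W k t ξ‖ ≤ G₀ ξ) (ξ : EuclideanSpace ℝ ι) : 0 ≤ G₀ ξ :=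
  le_trans (by positivity) (hG 0 ⟨le_rfl, hT⟩ ξ)

/-- **Integrable dominators of every order**: `(1 + ‖ξ‖)^K ‖W_k(t, ξ)‖ ≤ g(ξ)` on `[0, T]` with
`0 ≤ g ∈ L¹` (`g = G_{K+K₀} (1+‖ξ‖)^{-K₀}`, a product of two square-integrable functions). [folklore] -/
theorem IsDomFamily.dom_L1 (h : IsDomFamily T n W) (hT : 0 ≤ T) {k : ℕ} (hk : k ≤ n) (K : ℕ) :
    ∃ g : EuclideanSpace ℝ ι → ℝ, Integrable g volume ∧ (∀ ξ, 0 ≤ g ξ) ∧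
      ∀ t ∈ Icc 0 T, ∀ ξ, (1 + ‖ξ‖) ^ K * ‖W k t ξ‖ ≤ g ξ := by
  set K₀ := Fintype.card ι + 1
  obtain ⟨G₀, hG₀, hle⟩ := h.dom k hk (K + K₀)
  have hw : MemLp (fun ξ : EuclideanSpace ℝ ι => ((1 + ‖ξ‖) ^ K₀)⁻¹) 2 volume := memLp_inv_one_add_norm_pow_two
  refine ⟨fun ξ => G₀ ξ * ((1 + ‖ξ‖) ^ K₀)⁻¹, hG₀.integrable_mul hw, fun ξ =>
    mul_nonneg (IsDomFamily.dom_nonneg hT hle ξ) (by positivity), fun t ht ξ => ?_⟩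
  have hpos : 0 < (1 + ‖ξ‖) ^ K₀ := by positivity
  rw [le_mul_inv_iff₀ hpos]
  calc (1 + ‖ξ‖) ^ K * ‖W k t ξ‖ * (1 + ‖ξ‖) ^ K₀ = (1 + ‖ξ‖) ^ (K + K₀) * ‖W k t ξ‖ := by rw [pow_add]; ring
    _ ≤ G₀ ξ := hle t ht ξ

/-- Time slices of a square-dominated family are integrable on `[0, T]`. [folklore] -/
theorem IsDomFamily.integrable (h : IsDomFamily T n W) {k : ℕ} (hk : k ≤ n) {t : ℝ} (ht : t ∈ Icc 0 T) :
    Integrable (W k t) volume := by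
  obtain ⟨g, hg, -, hle⟩ := h.dom_L1 (ht.1.trans ht.2) hk 0
  exact hg.mono' (h.meas k hk t ht) (Eventually.of_forall fun ξ => by simpa using hle t ht ξ)

/-- Time slices of a square-dominated family are square integrable on `[0, T]`, with weights. [folklore] -/
theorem IsDomFamily.memLp_wmul (h : IsDomFamily T n W) {k : ℕ} (hk : k ≤ n) (K : ℕ) {t : ℝ} (ht : t ∈ Icc 0 T) :
    MemLp (fun ξ : EuclideanSpace ℝ ι => ((1 + ‖ξ‖) ^ K : ℝ) • W k t ξ) 2 volume := by
  obtain ⟨G₀, hG₀, hle⟩ := h.dom k hk K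
  refine ⟨((by fun_prop : Continuous fun ξ : EuclideanSpace ℝ ι => (1 + ‖ξ‖) ^ K).aestronglyMeasurable.smul
    (h.meas k hk t ht)), ?_⟩
  refine (eLpNorm_mono_real (g := G₀) fun ξ => ?_).trans_lt hG₀.eLpNorm_lt_top
  rw [norm_smul, Real.norm_of_nonneg (by positivity)]
  exact hle t ht ξ

/-! #### Algebra of square-dominated families -/

/-- Restriction to fewer derivatives. [folklore] -/
theorem IsDomFamily.mono (h : IsDomFamily T n W) {m : ℕ} (hm : m ≤ n) : IsDomFamily T m W where
  meas k hk := h.meas k (hk.trans hm)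
  dom k hk := h.dom k (hk.trans hm)
  cont k hk := h.cont k (hk.trans hm)
  deriv k hk := h.deriv k (lt_of_lt_of_le hk hm)

/-- **Shift**: the family of `∂ₜ W₀ = W₁`. [folklore] -/
theorem IsDomFamily.shift (h : IsDomFamily T (n + 1) W) : IsDomFamily T n (fun k => W (k + 1)) where
  meas k hk := h.meas (k + 1) (by omega)
  dom k hk := h.dom (k + 1) (by omega)
  cont k hk := h.cont (k + 1) (by omega)
  deriv k hk := h.deriv (k + 1) (by omega)

/-- Sums of families. [folklore] -/
theorem IsDomFamily.add (h : IsDomFamily T n W) (h' : IsDomFamily T n W') :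
    IsDomFamily T n (fun k t ξ => W k t ξ + W' k t ξ) where
  meas k hk t ht := (h.meas k hk t ht).add (h'.meas k hk t ht)
  dom k hk K := by
    obtain ⟨G₁, hG₁, h₁⟩ := h.dom k hk K
    obtain ⟨G₂, hG₂, h₂⟩ := h'.dom k hk K
    refine ⟨fun ξ => G₁ ξ + G₂ ξ, hG₁.add hG₂, fun t ht ξ => ?_⟩
    calc (1 + ‖ξ‖) ^ K * ‖W k t ξ + W' k t ξ‖ ≤ (1 + ‖ξ‖) ^ K * (‖W k t ξ‖ + ‖W' k t ξ‖) := by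
          gcongr; exact norm_add_le _ _
      _ ≤ G₁ ξ + G₂ ξ := by rw [mul_add]; exact add_le_add (h₁ t ht ξ) (h₂ t ht ξ)
  cont k hk ξ := (h.cont k hk ξ).add (h'.cont k hk ξ)
  deriv k hk ξ t ht := (h.deriv k hk ξ t ht).add (h'.deriv k hk ξ t ht)

/-- Negation. [folklore] -/
theorem IsDomFamily.neg (h : IsDomFamily T n W) : IsDomFamily T n (fun k t ξ => -W k t ξ) where
  meas k hk t ht := (h.meas k hk t ht).neg
  dom k hk K := by
    obtain ⟨G₁, hG₁, h₁⟩ := h.dom k hk K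
    exact ⟨G₁, hG₁, fun t ht ξ => by rw [norm_neg]; exact h₁ t ht ξ⟩
  cont k hk ξ := (h.cont k hk ξ).neg
  deriv k hk ξ t ht := (h.deriv k hk ξ t ht).neg

/-- Differences. [folklore] -/
theorem IsDomFamily.sub (h : IsDomFamily T n W) (h' : IsDomFamily T n W') :
    IsDomFamily T n (fun k t ξ => W k t ξ - W' k t ξ) := by
  simpa [sub_eq_add_neg] using h.add h'.neg

/-- **Multiplication by a time-independent symbol of polynomial growth.** [folklore] -/
theorem IsDomFamily.symbol (h : IsDomFamily T n W) {m : EuclideanSpace ℝ ι → ℂ} (hm : AEStronglyMeasurable m volume)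
    {d : ℕ} {M : ℝ} (hM : 0 ≤ M) (hgrowth : ∀ ξ, ‖m ξ‖ ≤ M * (1 + ‖ξ‖) ^ d) :
    IsDomFamily T n (fun k t ξ => m ξ * W k t ξ) where
  meas k hk t ht := hm.mul (h.meas k hk t ht)
  dom k hk K := by
    obtain ⟨G₁, hG₁, h₁⟩ := h.dom k hk (K + d)
    refine ⟨fun ξ => M * G₁ ξ, hG₁.const_mul M, fun t ht ξ => ?_⟩
    rw [norm_mul]
    calc (1 + ‖ξ‖) ^ K * (‖m ξ‖ * ‖W k t ξ‖) ≤ (1 + ‖ξ‖) ^ K * (M * (1 + ‖ξ‖) ^ d * ‖W k t ξ‖) := by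
          gcongr; exact hgrowth ξ
      _ = M * ((1 + ‖ξ‖) ^ (K + d) * ‖W k t ξ‖) := by rw [pow_add]; ring
      _ ≤ M * G₁ ξ := mul_le_mul_of_nonneg_left (h₁ t ht ξ) hM
  cont k hk ξ := continuousOn_const.mul (h.cont k hk ξ)
  deriv k hk ξ t ht := by simpa using (h.deriv k hk ξ t ht).const_mul (m ξ)

/-- Constant multiples. [folklore] -/
theorem IsDomFamily.const_mul (h : IsDomFamily T n W) (c : ℂ) : IsDomFamily T n (fun k t ξ => c * W k t ξ) :=
  h.symbol (m := fun _ => c) aestronglyMeasurable_const (d := 0) (norm_nonneg c) (fun ξ => by simp)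

/-- Finite sums of families (`0 ≤ T`). [folklore] -/
theorem IsDomFamily.finset_sum {β : Type*} (s : Finset β) {Wf : β → ℕ → ℝ → EuclideanSpace ℝ ι → ℂ}
    (h : ∀ b ∈ s, IsDomFamily T n (Wf b)) : IsDomFamily T n (fun k t ξ => ∑ b ∈ s, Wf b k t ξ) := by
  classical
  induction s using Finset.induction_on with
  | empty =>
    exact { meas := fun k hk t ht => by simpa using aestronglyMeasurable_const
            dom := fun k hk K => ⟨0, MemLp.zero, fun t ht ξ => by simp⟩
            cont := fun k hk ξ => by simpa using continuousOn_const
            deriv := fun k hk ξ t ht => by simpa using hasDerivWithinAt_const t (Icc 0 T) (0:ℂ) }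
  | insert b s hb ih =>
    have h1 := (h b (Finset.mem_insert_self b s)).add (ih fun b' hb' => h b' (Finset.mem_insert_of_mem hb'))
    simpa [Finset.sum_insert hb] using h1

/-- Uniform-in-`k` choice of dominators of order `K`. [folklore] -/
theorem IsDomFamily.dom' (h : IsDomFamily T n W) (K : ℕ) :
    ∃ Gf : ℕ → EuclideanSpace ℝ ι → ℝ, ∀ k ≤ n, MemLp (Gf k) 2 volume ∧
      ∀ t ∈ Icc 0 T, ∀ ξ, (1 + ‖ξ‖) ^ K * ‖W k t ξ‖ ≤ Gf k ξ := by
  classical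
  have : ∀ k, ∃ G₀ : EuclideanSpace ℝ ι → ℝ, k ≤ n → MemLp G₀ 2 volume ∧
      ∀ t ∈ Icc 0 T, ∀ ξ, (1 + ‖ξ‖) ^ K * ‖W k t ξ‖ ≤ G₀ ξ := fun k => by
    by_cases hk : k ≤ n
    · obtain ⟨G₀, hG₀, hle⟩ := h.dom k hk K; exact ⟨G₀, fun _ => ⟨hG₀, hle⟩⟩
    · exact ⟨0, fun h' => absurd h' hk⟩
  choose Gf hGf using this
  exact ⟨Gf, hGf⟩

/-! #### Convolution of two square-dominated families -/

/-- Translation-reflection of a square-integrable dominator: `η ↦ G(ξ - η) ∈ L²`, with the same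
`∫ G²`. [folklore] -/
theorem memLp_comp_sub_left_real {G₀ : EuclideanSpace ℝ ι → ℝ} (hG : MemLp G₀ 2 volume) (ξ : EuclideanSpace ℝ ι) :
    MemLp (fun η => G₀ (ξ - η)) 2 volume :=
  hG.comp_measurePreserving (Measure.measurePreserving_sub_left volume ξ)

/-- The product of a dominator and a translated-reflected dominator is integrable. [folklore] -/
theorem integrable_dom_mul_dom {G₁ G₂ : EuclideanSpace ℝ ι → ℝ} (h₁ : MemLp G₁ 2 volume) (h₂ : MemLp G₂ 2 volume)
    (ξ : EuclideanSpace ℝ ι) : Integrable (fun η => G₁ η * G₂ (ξ - η)) volume :=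
  h₁.integrable_mul (memLp_comp_sub_left_real h₂ ξ)

/-- **Cauchy–Schwarz for the dominators**: `∫ G₁(η) G₂(ξ - η) dη ≤ ‖G₁‖_{L²} ‖G₂‖_{L²}` (with the
real `L²` norms `(∫ G²)^{1/2}`), for nonnegative `G₁, G₂ ∈ L²`. [folklore] -/
theorem integral_dom_mul_dom_le {G₁ G₂ : EuclideanSpace ℝ ι → ℝ} (h₁ : MemLp G₁ 2 volume) (h₂ : MemLp G₂ 2 volume)
    (h₁0 : ∀ η, 0 ≤ G₁ η) (h₂0 : ∀ η, 0 ≤ G₂ η) (ξ : EuclideanSpace ℝ ι) :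
    ∫ η, G₁ η * G₂ (ξ - η) ≤ (∫ η, G₁ η ^ (2 : ℝ)) ^ (1 / 2 : ℝ) * (∫ η, G₂ η ^ (2 : ℝ)) ^ (1 / 2 : ℝ) := by
  have h := integral_mul_le_Lp_mul_Lq_of_nonneg (μ := (volume : Measure (EuclideanSpace ℝ ι))) Real.HolderConjugate.two_two
    (Eventually.of_forall h₁0) (Eventually.of_forall fun η => h₂0 (ξ - η)) (by simpa using h₁)
    (by simpa using memLp_comp_sub_left_real h₂ ξ)
  refine h.trans (le_of_eq ?_)
  congr 2
  exact integral_sub_left_eq_self (fun η => G₂ η ^ (2 : ℝ)) volume ξ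

/-- **Pointwise decay of the convolution of two square-dominated functions**: if
`(1+‖η‖)^K ‖f η‖ ≤ G₁ η` and `(1+‖η‖)^K ‖g η‖ ≤ G₂ η` with `G₁, G₂ ∈ L²`, then
`(1 + ‖ξ‖)^K ‖(f ⋆ g)(ξ)‖ ≤ ‖G₁‖_{L²} ‖G₂‖_{L²}` (weight triangle inequality and Cauchy–Schwarz). [folklore] -/
theorem pow_mul_norm_fconv_le {K : ℕ} {f g : EuclideanSpace ℝ ι → ℂ} {G₁ G₂ : EuclideanSpace ℝ ι → ℝ}
    (h₁ : MemLp G₁ 2 volume) (h₂ : MemLp G₂ 2 volume) (hf : ∀ η, (1 + ‖η‖) ^ K * ‖f η‖ ≤ G₁ η)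
    (hg : ∀ η, (1 + ‖η‖) ^ K * ‖g η‖ ≤ G₂ η) (ξ : EuclideanSpace ℝ ι) :
    (1 + ‖ξ‖) ^ K * ‖fconv f g ξ‖ ≤ (∫ η, G₁ η ^ (2 : ℝ)) ^ (1 / 2 : ℝ) * (∫ η, G₂ η ^ (2 : ℝ)) ^ (1 / 2 : ℝ) := by
  have h₁0 : ∀ η, 0 ≤ G₁ η := fun η => le_trans (by positivity) (hf η)
  have h₂0 : ∀ η, 0 ≤ G₂ η := fun η => le_trans (by positivity) (hg η)
  rw [fconv_apply, ← norm_of_nonneg (by positivity : (0 : ℝ) ≤ (1 + ‖ξ‖) ^ K), ← norm_smul, ← integral_smul]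
  refine (norm_integral_le_of_norm_le (integrable_dom_mul_dom h₁ h₂ ξ) (Eventually.of_forall fun η => ?_)).trans
    (integral_dom_mul_dom_le h₁ h₂ h₁0 h₂0 ξ)
  rw [norm_smul, norm_of_nonneg (by positivity : (0 : ℝ) ≤ (1 + ‖ξ‖) ^ K), norm_mul]
  calc (1 + ‖ξ‖) ^ K * (‖f η‖ * ‖g (ξ - η)‖) ≤ ((1 + ‖η‖) * (1 + ‖ξ - η‖)) ^ K * (‖f η‖ * ‖g (ξ - η)‖) := by
        gcongr; rw [mul_comm]; exact one_add_norm_le_mul ξ η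
    _ = ((1 + ‖η‖) ^ K * ‖f η‖) * ((1 + ‖ξ - η‖) ^ K * ‖g (ξ - η)‖) := by rw [mul_pow]; ring
    _ ≤ G₁ η * G₂ (ξ - η) := mul_le_mul (hf η) (hg (ξ - η)) (by positivity) (h₁0 η)

/-- The convolution integrand of two square-dominated functions is integrable. [folklore] -/
theorem integrable_fconv_integrand_dom {f g : EuclideanSpace ℝ ι → ℂ} {G₁ G₂ : EuclideanSpace ℝ ι → ℝ}
    (h₁ : MemLp G₁ 2 volume) (h₂ : MemLp G₂ 2 volume) (hf : ∀ η, ‖f η‖ ≤ G₁ η) (hg : ∀ η, ‖g η‖ ≤ G₂ η)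
    (hfm : AEStronglyMeasurable f volume) (hgm : AEStronglyMeasurable g volume) (ξ : EuclideanSpace ℝ ι) :
    Integrable (fun η => f η * g (ξ - η)) volume :=
  (integrable_dom_mul_dom h₁ h₂ ξ).mono' (aestronglyMeasurable_fconv_integrand hfm hgm ξ)
    (Eventually.of_forall fun η => by
      rw [norm_mul]; exact mul_le_mul (hf η) (hg (ξ - η)) (norm_nonneg _) ((norm_nonneg _).trans (hf η)))

/-- Order-`0` dominators bound the function itself. [folklore] -/
theorem IsDomFamily.norm_le_of_dom {G₀ : EuclideanSpace ℝ ι → ℝ} {k : ℕ}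
    (hle : ∀ t ∈ Icc 0 T, ∀ ξ, (1 + ‖ξ‖) ^ 0 * ‖W k t ξ‖ ≤ G₀ ξ) {t : ℝ} (ht : t ∈ Icc 0 T) (ξ : EuclideanSpace ℝ ι) :
    ‖W k t ξ‖ ≤ G₀ ξ := by simpa using hle t ht ξ

/-- **Derivative of the convolution of two square-dominated families within `[0, T]`**:
`∂ₜ (F_i ⋆ G_j) = F_{i+1} ⋆ G_j + F_i ⋆ G_{j+1}` for `i, j < n` (differentiation under the
integral sign, the bound being a sum of products of dominators). [folklore] -/
theorem IsDomFamily.hasDerivWithinAt_fconv (hT : 0 < T) (hF : IsDomFamily T n F) (hG : IsDomFamily T n G)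
    {i j : ℕ} (hi : i < n) (hj : j < n) (ξ : EuclideanSpace ℝ ι) {t : ℝ} (ht : t ∈ Icc 0 T) :
    HasDerivWithinAt (fun s => fconv (F i s) (G j s) ξ)
      (fconv (F (i + 1) t) (G j t) ξ + fconv (F i t) (G (j + 1) t) ξ) (Icc 0 T) t := by
  obtain ⟨A, hA, hAle⟩ := hF.dom i hi.le 0
  obtain ⟨A₁, hA₁, hA₁le⟩ := hF.dom (i + 1) hi 0
  obtain ⟨B, hB, hBle⟩ := hG.dom j hj.le 0
  obtain ⟨B₁, hB₁, hB₁le⟩ := hG.dom (j + 1) hj 0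
  set Φ : ℝ → EuclideanSpace ℝ ι → ℂ := fun s η => F i s η * G j s (ξ - η) with hΦ
  set Φ' : ℝ → EuclideanSpace ℝ ι → ℂ := fun s η =>
    F (i + 1) s η * G j s (ξ - η) + F i s η * G (j + 1) s (ξ - η) with hΦ'
  have hΦm : ∀ s ∈ Icc 0 T, AEStronglyMeasurable (Φ s) volume := fun s hs =>
    aestronglyMeasurable_fconv_integrand (hF.meas i hi.le s hs) (hG.meas j hj.le s hs) ξ
  have hΦ'm : ∀ s ∈ Icc 0 T, AEStronglyMeasurable (Φ' s) volume := fun s hs =>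
    (aestronglyMeasurable_fconv_integrand (hF.meas (i + 1) hi s hs) (hG.meas j hj.le s hs) ξ).add
      (aestronglyMeasurable_fconv_integrand (hF.meas i hi.le s hs) (hG.meas (j + 1) hj s hs) ξ)
  have hΦint : ∀ s ∈ Icc 0 T, Integrable (Φ s) := fun s hs =>
    integrable_fconv_integrand_dom hA hB (IsDomFamily.norm_le_of_dom hAle hs) (IsDomFamily.norm_le_of_dom hBle hs)
      (hF.meas i hi.le s hs) (hG.meas j hj.le s hs) ξ
  set bound : EuclideanSpace ℝ ι → ℝ := fun η => A₁ η * B (ξ - η) + A η * B₁ (ξ - η) with hbound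
  have hbound_int : Integrable bound := (integrable_dom_mul_dom hA₁ hB ξ).add (integrable_dom_mul_dom hA hB₁ ξ)
  have h_bd : ∀ s ∈ Icc 0 T, ∀ η, ‖Φ' s η‖ ≤ bound η := by
    intro s hs η
    have e1 : ‖F (i + 1) s η * G j s (ξ - η)‖ ≤ A₁ η * B (ξ - η) := by
      rw [norm_mul]
      exact mul_le_mul (IsDomFamily.norm_le_of_dom hA₁le hs η) (IsDomFamily.norm_le_of_dom hBle hs _) (norm_nonneg _)
        ((norm_nonneg _).trans (IsDomFamily.norm_le_of_dom hA₁le hs η))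
    have e2 : ‖F i s η * G (j + 1) s (ξ - η)‖ ≤ A η * B₁ (ξ - η) := by
      rw [norm_mul]
      exact mul_le_mul (IsDomFamily.norm_le_of_dom hAle hs η) (IsDomFamily.norm_le_of_dom hB₁le hs _) (norm_nonneg _)
        ((norm_nonneg _).trans (IsDomFamily.norm_le_of_dom hAle hs η))
    exact (norm_add_le _ _).trans (add_le_add e1 e2)
  have h_df : ∀ η, ∀ s ∈ Icc 0 T, HasDerivWithinAt (Φ · η) (Φ' s η) (Icc 0 T) s := by
    intro η s hs
    have h3 := (hF.deriv i hi η s hs).mul (hG.deriv j hj (ξ - η) s hs)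
    simp only [hΦ, hΦ']
    exact h3
  have h := hasDerivWithinAt_integral_Icc (μ := (volume : Measure (EuclideanSpace ℝ ι))) hT hΦm hΦ'm hΦint h_bd
    hbound_int h_df ht
  have hint1 : Integrable fun η => F (i + 1) t η * G j t (ξ - η) :=
    integrable_fconv_integrand_dom hA₁ hB (IsDomFamily.norm_le_of_dom hA₁le ht) (IsDomFamily.norm_le_of_dom hBle ht)
      (hF.meas (i + 1) hi t ht) (hG.meas j hj.le t ht) ξ
  have hint2 : Integrable fun η => F i t η * G (j + 1) t (ξ - η) :=
    integrable_fconv_integrand_dom hA hB₁ (IsDomFamily.norm_le_of_dom hAle ht) (IsDomFamily.norm_le_of_dom hB₁le ht)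
      (hF.meas i hi.le t ht) (hG.meas (j + 1) hj t ht) ξ
  have heq : (∫ η, Φ' t η) = fconv (F (i + 1) t) (G j t) ξ + fconv (F i t) (G (j + 1) t) ξ := by
    rw [fconv_apply, fconv_apply, ← integral_add hint1 hint2]
  rw [heq] at h
  exact h.congr (fun s _ => fconv_apply _ _ _) (fconv_apply _ _ _)

/-- Continuity in time of the convolution of two square-dominated families on `[0, T]`
(dominated convergence). [folklore] -/
theorem IsDomFamily.continuousOn_fconv (hF : IsDomFamily T n F) (hG : IsDomFamily T n G) {i j : ℕ} (hi : i ≤ n)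
    (hj : j ≤ n) (ξ : EuclideanSpace ℝ ι) : ContinuousOn (fun s => fconv (F i s) (G j s) ξ) (Icc 0 T) := by
  obtain ⟨A, hA, hAle⟩ := hF.dom i hi 0
  obtain ⟨B, hB, hBle⟩ := hG.dom j hj 0
  have heq : (fun s => fconv (F i s) (G j s) ξ) = fun s => ∫ η, F i s η * G j s (ξ - η) := funext fun s => fconv_apply _ _ _
  rw [heq]
  refine continuousOn_of_dominated (bound := fun η => A η * B (ξ - η)) (fun s hs =>
    aestronglyMeasurable_fconv_integrand (hF.meas i hi s hs) (hG.meas j hj s hs) ξ) (fun s hs =>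
    Eventually.of_forall fun η => ?_) (integrable_dom_mul_dom hA hB ξ) (Eventually.of_forall fun η => ?_)
  · rw [norm_mul]
    exact mul_le_mul (IsDomFamily.norm_le_of_dom hAle hs η) (IsDomFamily.norm_le_of_dom hBle hs _) (norm_nonneg _)
      ((norm_nonneg _).trans (IsDomFamily.norm_le_of_dom hAle hs η))
  · exact (hF.cont i hi η).mul (hG.cont j hj (ξ - η))

/-- **Leibniz rule for square-dominated families**: the Leibniz family
`L_k = ∑_{i ≤ k} C(k,i) F_i ⋆ G_{k-i}` of two square-dominated families is a pointwise-decaying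
Fourier family (`IsFourierFamily`): decay of every order by `pow_mul_norm_fconv_le`, time
continuity by dominated convergence, `∂ₜ L_k = L_{k+1}` by `hasDerivWithinAt_fconv` and
`Finset.sum_choose_succ_mul`. [folklore] -/
theorem IsDomFamily.leibniz (hT : 0 < T) (hF : IsDomFamily T n F) (hG : IsDomFamily T n G) :
    IsFourierFamily T n (leibnizFamily F G) := by
  refine ⟨fun k hk t ht => ?_, fun k hk K => ?_, fun k hk ξ => ?_, fun k hk ξ t ht => ?_⟩
  · change AEStronglyMeasurable (fun ξ => ∑ i ∈ Finset.range (k + 1),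
      (k.choose i : ℂ) * fconv (F i t) (G (k - i) t) ξ) volume
    refine Finset.aestronglyMeasurable_fun_sum _ fun i hi => ?_
    have hi' : i ≤ n := (Nat.lt_succ_iff.1 (Finset.mem_range.1 hi)).trans hk
    exact aestronglyMeasurable_const.mul (aestronglyMeasurable_fconv (hF.integrable hi' ht) (hG.integrable (by omega) ht))
  · obtain ⟨Af, hAf⟩ := hF.dom' K
    obtain ⟨Bf, hBf⟩ := hG.dom' K
    refine ⟨∑ i ∈ Finset.range (k + 1), ‖(k.choose i : ℂ)‖ *
      ((∫ η, Af i η ^ (2 : ℝ)) ^ (1 / 2 : ℝ) * (∫ η, Bf (k - i) η ^ (2 : ℝ)) ^ (1 / 2 : ℝ)), fun t ht => ?_⟩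
    refine hasDecay_finset_sum _ fun i hi => ?_
    have hi' : i ≤ n := (Nat.lt_succ_iff.1 (Finset.mem_range.1 hi)).trans hk
    have hki : k - i ≤ n := by omega
    refine HasDecay.const_mul (fun ξ => ?_) _
    have hpos : 0 < (1 + ‖ξ‖) ^ K := by positivity
    rw [le_mul_inv_iff₀ hpos, mul_comm]
    exact pow_mul_norm_fconv_le (hAf i hi').1 (hBf (k - i) hki).1 ((hAf i hi').2 t ht) ((hBf (k - i) hki).2 t ht) ξ
  · change ContinuousOn (fun t => ∑ i ∈ Finset.range (k + 1), (k.choose i : ℂ) * fconv (F i t) (G (k - i) t) ξ) (Icc 0 T)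
    refine continuousOn_finsetSum _ fun i hi => ?_
    have hi' : i ≤ n := (Nat.lt_succ_iff.1 (Finset.mem_range.1 hi)).trans hk
    exact continuousOn_const.mul (hF.continuousOn_fconv hG hi' (by omega) ξ)
  · have hderiv : HasDerivWithinAt (fun s => leibnizFamily F G k s ξ)
        (∑ i ∈ Finset.range (k + 1), (k.choose i : ℂ) *
          (fconv (F (i + 1) t) (G (k - i) t) ξ + fconv (F i t) (G (k - i + 1) t) ξ)) (Icc 0 T) t := by
      refine HasDerivWithinAt.fun_sum fun i hi => ?_
      have hi' : i ≤ k := Nat.lt_succ_iff.1 (Finset.mem_range.1 hi)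
      exact (hF.hasDerivWithinAt_fconv hT hG (by omega) (by omega) ξ ht).const_mul _
    convert hderiv using 1
    change ∑ i ∈ Finset.range (k + 1 + 1), ((k + 1).choose i : ℂ) * fconv (F i t) (G (k + 1 - i) t) ξ = _
    have h := Finset.sum_choose_succ_mul (fun a b => fconv (F a t) (G b t) ξ) k
    rw [show k + 1 + 1 = k + 2 from rfl, h, add_comm, ← Finset.sum_add_distrib]
    refine Finset.sum_congr rfl fun i hi => ?_
    have hi' : i ≤ k := Nat.lt_succ_iff.1 (Finset.mem_range.1 hi)
    rw [Nat.sub_add_comm hi', mul_add]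

/-! #### The nonlinearity and the pressure symbol of two square-dominated vector families -/

variable [DecidableEq ι]

/-- **The nonlinearity of two square-dominated vector families is a (pointwise-decaying)
family** (componentwise). [folklore] -/
theorem IsDomFamily.nonlinFamily (hT : 0 < T) {V W : ℕ → ℝ → EuclideanSpace ℝ ι → ι → ℂ}
    (hV : ∀ j, IsDomFamily T n (fun k t ξ => V k t ξ j)) (hW : ∀ j, IsDomFamily T n (fun k t ξ => W k t ξ j)) (l : ι) :
    IsFourierFamily T n (fun k t ξ => nonlinFamily V W k t ξ l) := by
  unfold FourierNS.nonlinFamily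
  refine IsFourierFamily.const_mul ?_ _
  refine IsFourierFamily.finset_sum _ fun j _ => IsFourierFamily.finset_sum _ fun k' _ => ?_
  refine ((hV j).leibniz hT (hW k')).symbol
    ((continuous_lerayDerivSymbol j k' l).measurable.complex_ofReal.aestronglyMeasurable)
    (d := 1) (M := 2) (by norm_num) fun ξ => ?_
  calc ‖(lerayDerivSymbol j k' l ξ : ℂ)‖ ≤ 2 * ‖ξ‖ := norm_ofReal_lerayDerivSymbol_le j k' l ξ
    _ ≤ 2 * (1 + ‖ξ‖) ^ 1 := by rw [pow_one]; linarith [norm_nonneg ξ]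

omit [DecidableEq ι] in
/-- **The pressure symbol of two square-dominated vector families is a (pointwise-decaying)
family.** [folklore] -/
theorem IsDomFamily.presFamily (hT : 0 < T) {V W : ℕ → ℝ → EuclideanSpace ℝ ι → ι → ℂ}
    (hV : ∀ j, IsDomFamily T n (fun k t ξ => V k t ξ j)) (hW : ∀ j, IsDomFamily T n (fun k t ξ => W k t ξ j)) :
    IsFourierFamily T n (presFamily V W) := by
  unfold FourierNS.presFamily
  refine IsFourierFamily.neg ?_
  refine IsFourierFamily.finset_sum _ fun j _ => IsFourierFamily.finset_sum _ fun k' _ => ?_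
  refine ((hV j).leibniz hT (hW k')).symbol ((measurable_presMultiplier j k').complex_ofReal.aestronglyMeasurable)
    (d := 0) (M := 1) zero_le_one fun ξ => ?_
  rw [pow_zero, mul_one, Complex.norm_real, Real.norm_eq_abs]
  exact abs_mul_div_norm_sq_le_one j k' ξ

end Family

end Literature.Analysis.FluidPDE.FourierNS

end
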